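import Summits.AtomisticToContinuum.Crystallization.Theses.PhononSlackCertificates

/-!
# `PeriodicGivenLayered` (stmt-AtomisticToContinuum-11779), line `Sketch` — extraction, part 1:
# re-indexing the layers of a layered window

Support file for the stub `stub_extraction` (one layered set in the hull, by compactness) of the
line `Sketch` of `PeriodicGivenLayered`. Pure bookkeeping about the layered sets
`{A (i u(a) + j v(a) + L_s(m) w(a) + z(m) e₃)}` of the window predicate of `LayeredWindows`:

* `ext_growth` — heights with increments in `[lo, hi]` grow linearly;
* `ext_exists_index` — some layer has height in `[−17a/20, 0]`;
* `ext_haggLabel_shift` — labels of the re-indexed Hägg word `s (· + m₀)`;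
* `ext_point_shift` — re-indexing the layers by `m₀` translates the layered set by `−A (r w)`,
  `r = L_s(m₀) mod 3` (because `3 w = u + v`);
* `ext_match_mono`, `ext_match_translate` — monotonicity of a two-way match in `(R, ε)` and its
  behaviour under a translation of the set by a vector of norm `≤ 2`;
* `ext_normalise` — every `(R + 2, ε)`-window has a re-indexed copy (same rigid motion, new
  translation) with `z 0 ∈ [−17a/20, 0]` which is an `(R, ε)`-window.

No definitions.
-/

noncomputable section

namespace Summit.AtomisticToContinuum.Crystallization.Theorems.LayeredHull

open scoped BigOperators
open Filter Literature.MathematicalPhysics.StatisticalMechanics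

/-! ## Heights -/

/-- Linear growth of heights whose increments lie in `[lo, hi]`. [folklore] -/
theorem ext_growth {z : ℤ → ℝ} {lo hi : ℝ}
    (hz : ∀ m : ℤ, lo ≤ z (m + 1) - z m ∧ z (m + 1) - z m ≤ hi) (m : ℤ) (n : ℕ) :
    lo * n ≤ z (m + n) - z m ∧ z (m + n) - z m ≤ hi * n := by
  induction n with
  | zero => simp
  | succ n ih =>
    have h := hz (m + n)
    push_cast
    rw [← add_assoc]
    constructor <;> linarith [h.1, h.2, ih.1, ih.2]

/-- If the increments of `z` lie in `[39a/50, 17a/20]` (`a > 0`), some layer has height in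
`[−17a/20, 0]` (the last layer of non-positive height). [folklore] -/
theorem ext_exists_index {z : ℤ → ℝ} {a : ℝ} (ha : 0 < a)
    (hz : ∀ m : ℤ, 39 / 50 * a ≤ z (m + 1) - z m ∧ z (m + 1) - z m ≤ 17 / 20 * a) :
    ∃ m₀ : ℤ, -(17 / 20 * a) ≤ z m₀ ∧ z m₀ ≤ 0 := by
  have hlo : 0 < 39 / 50 * a := by positivity
  obtain ⟨n₀, hn₀⟩ := exists_nat_ge (|z 0| / (39 / 50 * a))
  have hn₀' : |z 0| ≤ 39 / 50 * a * n₀ := by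
    rw [div_le_iff₀ hlo] at hn₀
    linarith
  have habs := le_abs_self (z 0)
  have habs' := neg_abs_le (z 0)
  have hex : ∃ m : ℤ, z m ≤ 0 := by
    refine ⟨-(n₀ : ℤ), ?_⟩
    have h := (ext_growth hz (-(n₀ : ℤ)) n₀).1
    rw [neg_add_cancel] at h
    linarith
  have hbd : ∃ b : ℤ, ∀ m : ℤ, z m ≤ 0 → m ≤ b := by
    refine ⟨n₀, fun m hm => ?_⟩
    by_contra hlt
    obtain ⟨n, rfl⟩ := Int.eq_ofNat_of_zero_le (by omega : (0 : ℤ) ≤ m)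
    have h := (ext_growth hz 0 n).1
    rw [zero_add] at h
    have hn : (n₀ : ℝ) + 1 ≤ n := by exact_mod_cast (by omega : n₀ + 1 ≤ n)
    have hmul : 39 / 50 * a * ((n₀ : ℝ) + 1) ≤ 39 / 50 * a * n :=
      mul_le_mul_of_nonneg_left hn hlo.le
    linarith
  obtain ⟨m₀, hm₀, hmax⟩ := Int.exists_greatest_of_bdd hbd hex
  refine ⟨m₀, ?_, hm₀⟩
  have h1 : 0 < z (m₀ + 1) := by
    by_contra h
    have := hmax _ (not_lt.1 h)
    omega
  linarith [(hz m₀).2]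

/-! ## Re-indexing the layers -/

/-- Labels of the re-indexed word: `L_{s(·+m₀)}(m) = L_s(m + m₀) − L_s(m₀)`. [folklore] -/
theorem ext_haggLabel_shift (s : ℤ → ℤ) (m₀ m : ℤ) :
    haggLabel (fun i => s (i + m₀)) m = haggLabel s (m + m₀) - haggLabel s m₀ := by
  induction m with
  | zero => simp
  | succ n ih =>
    rw [haggLabel_succ, ih, show (n : ℤ) + 1 + m₀ = (n + m₀) + 1 by ring, haggLabel_succ]
    ring
  | pred n ih =>
    have h1 := haggLabel_succ (fun i => s (i + m₀)) (-(n : ℤ) - 1)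
    have h2 := haggLabel_succ s (-(n : ℤ) - 1 + m₀)
    rw [show -(n : ℤ) - 1 + 1 = -n by ring, ih] at h1
    rw [show -(n : ℤ) - 1 + m₀ + 1 = -n + m₀ by ring] at h2
    linarith

/-- Labels of two words agreeing on `|m| ≤ M` agree on `|m| ≤ M`. [folklore] -/
theorem ext_haggLabel_eq_of_eqOn {s s' : ℤ → ℤ} {M : ℕ} (h : ∀ m : ℤ, |m| ≤ M → s m = s' m)
    (m : ℤ) (hm : |m| ≤ M) : haggLabel s m = haggLabel s' m := by
  induction m with
  | zero => simp
  | succ n ih =>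
    have hn : |(n : ℤ)| ≤ M := by
      rw [abs_le] at hm ⊢; omega
    rw [haggLabel_succ, haggLabel_succ, ih hn, h n hn]
  | pred n ih =>
    have hn : |(-(n : ℤ))| ≤ M := by
      rw [abs_le] at hm ⊢; omega
    have h1 := haggLabel_succ s (-(n : ℤ) - 1)
    have h2 := haggLabel_succ s' (-(n : ℤ) - 1)
    rw [show -(n : ℤ) - 1 + 1 = -n by ring] at h1 h2
    rw [ih hn, h _ hm] at h1
    linarith

/-- **Re-indexing translates the layered set.** With `L_s(m₀) = 3 q + r`, the point `(m, i, j)`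
of the layered set of the re-indexed data `(s (· + m₀), z (· + m₀))` is the point
`(m + m₀, i − q, j − q)` of the original layered set translated by `−A (r • w)` (`3 w = u + v`,
`three_smul_barlowOffset`). [folklore] -/
theorem ext_point_shift (A : EuclideanSpace ℝ (Fin 3) →ₗᵢ[ℝ] EuclideanSpace ℝ (Fin 3)) (a : ℝ)
    (s : ℤ → ℤ) (z : ℤ → ℝ) {m₀ q r : ℤ} (hqr : haggLabel s m₀ = 3 * q + r) (m i j : ℤ) :
    A (((i : ℝ) • triangularVec₁ a) + ((j : ℝ) • triangularVec₂ a) +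
        ((haggLabel (fun k => s (k + m₀)) m : ℝ) • barlowOffset a) +
        (z (m + m₀) • layerNormal 1)) =
      A ((((i - q : ℤ) : ℝ) • triangularVec₁ a) + (((j - q : ℤ) : ℝ) • triangularVec₂ a) +
        ((haggLabel s (m + m₀) : ℝ) • barlowOffset a) + (z (m + m₀) • layerNormal 1)) -
      A ((r : ℝ) • barlowOffset a) := by
  rw [← A.map_sub]
  congr 1
  rw [ext_haggLabel_shift]
  have hdiv : ((haggLabel s m₀ : ℤ) : ℝ) = (q : ℝ) * 3 + (r : ℝ) := by
    rw [hqr]; push_cast; ring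
  have h3 := three_smul_barlowOffset a
  simp only [Int.cast_sub]
  rw [hdiv]
  simp only [sub_smul, add_smul, mul_smul, h3, smul_add]
  abel

/-! ## Two-way matches: monotonicity and translation of the set -/

/-- A two-way match is monotone in the radius and the tolerance. [folklore] -/
theorem ext_match_mono {N : ℕ} (y : Fin N → EuclideanSpace ℝ (Fin 3)) (t : EuclideanSpace ℝ (Fin 3))
    (S : Set (EuclideanSpace ℝ (Fin 3))) {R R' ε ε' : ℝ} (hR : R' ≤ R) (hε : ε ≤ ε')
    (h : (∀ p ∈ S, ‖p‖ ≤ R → ∃ i : Fin N, dist (y i + t) p ≤ ε) ∧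
      (∀ i : Fin N, ‖y i + t‖ ≤ R → ∃ p ∈ S, dist (y i + t) p ≤ ε)) :
    (∀ p ∈ S, ‖p‖ ≤ R' → ∃ i : Fin N, dist (y i + t) p ≤ ε') ∧
      (∀ i : Fin N, ‖y i + t‖ ≤ R' → ∃ p ∈ S, dist (y i + t) p ≤ ε') := by
  refine ⟨fun p hp hpR => ?_, fun i hi => ?_⟩
  · obtain ⟨i, hi⟩ := h.1 p hp (hpR.trans hR)
    exact ⟨i, hi.trans hε⟩
  · obtain ⟨p, hp, hd⟩ := h.2 i (hi.trans hR)
    exact ⟨p, hp, hd.trans hε⟩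

/-- **Translating the set.** If `S' = S − c` with `‖c‖ ≤ 2` and `y + t` is two-way `ε`-matched
with `S` on `‖·‖ ≤ R + 2`, then `y + (t − c)` is two-way `ε`-matched with `S'` on `‖·‖ ≤ R`.
[folklore] -/
theorem ext_match_translate {N : ℕ} (y : Fin N → EuclideanSpace ℝ (Fin 3))
    (t c : EuclideanSpace ℝ (Fin 3)) (S S' : Set (EuclideanSpace ℝ (Fin 3))) {R ε : ℝ}
    (hc : ‖c‖ ≤ 2) (hS' : ∀ p' ∈ S', p' + c ∈ S) (hS : ∀ p ∈ S, p - c ∈ S')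
    (h : (∀ p ∈ S, ‖p‖ ≤ R + 2 → ∃ i : Fin N, dist (y i + t) p ≤ ε) ∧
      (∀ i : Fin N, ‖y i + t‖ ≤ R + 2 → ∃ p ∈ S, dist (y i + t) p ≤ ε)) :
    (∀ p' ∈ S', ‖p'‖ ≤ R → ∃ i : Fin N, dist (y i + (t - c)) p' ≤ ε) ∧
      (∀ i : Fin N, ‖y i + (t - c)‖ ≤ R → ∃ p' ∈ S', dist (y i + (t - c)) p' ≤ ε) := by
  refine ⟨fun p' hp' hpR => ?_, fun i hi => ?_⟩
  · have hn : ‖p' + c‖ ≤ R + 2 := (norm_add_le _ _).trans (by linarith)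
    obtain ⟨i, hi⟩ := h.1 (p' + c) (hS' p' hp') hn
    refine ⟨i, ?_⟩
    rwa [dist_eq_norm, show y i + (t - c) - p' = y i + t - (p' + c) by abel, ← dist_eq_norm]
  · have hn : ‖y i + t‖ ≤ R + 2 := by
      have : ‖y i + t‖ ≤ ‖y i + (t - c)‖ + ‖c‖ := by
        rw [show y i + t = y i + (t - c) + c by abel]
        exact norm_add_le _ _
      linarith
    obtain ⟨p, hp, hd⟩ := h.2 i hn
    refine ⟨p - c, hS p hp, ?_⟩
    rwa [dist_eq_norm, show y i + (t - c) - (p - c) = y i + t - p by abel, ← dist_eq_norm]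

/-! ## Normalising a window -/

/-- `‖w(a)‖ ≤ 1` for `0 ≤ a ≤ 1` (`‖w‖² = a²/3`). [folklore] -/
theorem ext_norm_barlowOffset_le {a : ℝ} (ha0 : 0 ≤ a) (ha1 : a ≤ 1) : ‖barlowOffset a‖ ≤ 1 := by
  have h3 : Real.sqrt 3 ^ 2 = 3 := Real.sq_sqrt (by norm_num)
  rw [EuclideanSpace.norm_eq, Fin.sum_univ_three, Real.sqrt_le_one]
  simp [barlowOffset, abs_of_nonneg ha0, abs_of_nonneg (Real.sqrt_nonneg 3)]
  nlinarith [show a ^ 2 * Real.sqrt 3 ^ 2 = a ^ 2 * 3 by rw [h3]]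

/-- **Normalising a window.** A two-way `ε`-match of `y + t` on `‖·‖ ≤ R + 2` with the layered set
of `(A, s, z)` (increments of `z` in `[39a/50, 17a/20]`, `0 < a ≤ 1`) yields, after re-indexing
the layers and absorbing a translation of norm `≤ 2`, a two-way `ε`-match of `y + t'` on
`‖·‖ ≤ R` with the layered set of `(A, s', z')`, where now `z' 0 ∈ [−17a/20, 0]`. [folklore] -/
theorem ext_normalise {N : ℕ} (y : Fin N → EuclideanSpace ℝ (Fin 3)) {a R ε : ℝ} (ha0 : 0 < a)
    (ha1 : a ≤ 1) (A : EuclideanSpace ℝ (Fin 3) →ₗᵢ[ℝ] EuclideanSpace ℝ (Fin 3))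
    (t : EuclideanSpace ℝ (Fin 3)) (s : ℤ → ℤ) (z : ℤ → ℝ) (hs : IsHaggSeq s)
    (hz : ∀ m : ℤ, 39 / 50 * a ≤ z (m + 1) - z m ∧ z (m + 1) - z m ≤ 17 / 20 * a)
    (hW : let S : Set (EuclideanSpace ℝ (Fin 3)) :=
        {p | ∃ m i j : ℤ, p = A (((i : ℝ) • triangularVec₁ a) + ((j : ℝ) • triangularVec₂ a) +
          ((haggLabel s m : ℝ) • barlowOffset a) + (z m • layerNormal 1))}
      (∀ p ∈ S, ‖p‖ ≤ R + 2 → ∃ i : Fin N, dist (y i + t) p ≤ ε) ∧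
      (∀ i : Fin N, ‖y i + t‖ ≤ R + 2 → ∃ p ∈ S, dist (y i + t) p ≤ ε)) :
    ∃ (t' : EuclideanSpace ℝ (Fin 3)) (s' : ℤ → ℤ) (z' : ℤ → ℝ), IsHaggSeq s' ∧
      (∀ m : ℤ, 39 / 50 * a ≤ z' (m + 1) - z' m ∧ z' (m + 1) - z' m ≤ 17 / 20 * a) ∧
      (-(17 / 20 * a) ≤ z' 0 ∧ z' 0 ≤ 0) ∧
      let S' : Set (EuclideanSpace ℝ (Fin 3)) :=
        {p | ∃ m i j : ℤ, p = A (((i : ℝ) • triangularVec₁ a) + ((j : ℝ) • triangularVec₂ a) +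
          ((haggLabel s' m : ℝ) • barlowOffset a) + (z' m • layerNormal 1))}
      (∀ p ∈ S', ‖p‖ ≤ R → ∃ i : Fin N, dist (y i + t') p ≤ ε) ∧
      (∀ i : Fin N, ‖y i + t'‖ ≤ R → ∃ p ∈ S', dist (y i + t') p ≤ ε) := by
  dsimp only at hW
  obtain ⟨m₀, hm₀⟩ := ext_exists_index ha0 hz
  obtain ⟨q, r, hqr, hr0, hr3⟩ : ∃ q r : ℤ, haggLabel s m₀ = 3 * q + r ∧ 0 ≤ r ∧ r ≤ 2 :=
    ⟨haggLabel s m₀ / 3, haggLabel s m₀ % 3, by omega, by omega, by omega⟩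
  have hcn : ‖A ((r : ℝ) • barlowOffset a)‖ ≤ 2 := by
    have hr2 : |(r : ℝ)| ≤ 2 := by
      rw [abs_le]
      constructor
      · exact_mod_cast (by omega : (-2 : ℤ) ≤ r)
      · exact_mod_cast hr3
    rw [A.norm_map, norm_smul, Real.norm_eq_abs]
    calc |(r : ℝ)| * ‖barlowOffset a‖ ≤ 2 * 1 :=
          mul_le_mul hr2 (ext_norm_barlowOffset_le ha0.le ha1) (norm_nonneg _) (by norm_num)
      _ = 2 := by norm_num
  refine ⟨t - A ((r : ℝ) • barlowOffset a), fun k => s (k + m₀), fun k => z (k + m₀),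
    fun k => hs (k + m₀), fun m => ?_, by simpa using hm₀, ?_⟩
  · show 39 / 50 * a ≤ z (m + 1 + m₀) - z (m + m₀) ∧ z (m + 1 + m₀) - z (m + m₀) ≤ 17 / 20 * a
    have := hz (m + m₀)
    rwa [show m + m₀ + 1 = m + 1 + m₀ by ring] at this
  dsimp only
  refine ext_match_translate y t _ _ _ hcn ?_ ?_ hW
  · rintro p' ⟨m, i, j, rfl⟩
    refine ⟨m + m₀, i - q, j - q, ?_⟩
    rw [ext_point_shift A a s z hqr, sub_add_cancel]
  · rintro p ⟨m, i, j, rfl⟩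
    refine ⟨m - m₀, i + q, j + q, ?_⟩
    rw [ext_point_shift A a s z hqr]
    simp only [sub_add_cancel, add_sub_cancel_right]

end Summit.AtomisticToContinuum.Crystallization.Theorems.LayeredHull

end
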